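import Summits.CriticalPhenomena.SAWScalingLimit.Theses.SAWRenewalTightness
import Summits.CriticalPhenomena.SAWScalingLimit.Theorems.SAWRenewalTightnessShellCrossingBoundTravCount
import Literature.Probability.RandomPlanarGeometry.PinchUnionBound
import Literature.Probability.RandomPlanarGeometry.CurveTortuosity
import HarnessLib

/-!
# `ShellCrossingBound` from the two-strand pinch bound away from the marked points (glue, landed)

Crux item `stmt-CriticalPhenomena-4728` (`SAWRenewalTightness.ShellCrossingBound`).  This file puts
IN THE TREE (importable, sorry-free) the one-statement closure of the crux that the line skeletons
`Cruxes/ShellCrossingBound/Lines/socket_comparison.lean` (seat -0) and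
`Cruxes/ShellCrossingBound/Lines/pinch_on_a_circle.lean` (seats c1-0, c2-0) prove in their workfiles:

  `PinchAway`  (registered S0 text: fixed threshold FOUR, any exponent `1 + s > 1`,
                centres `d`-away from both marked points, original domain, `δ ≤ η < R ≤ R₀`)
    ⟹ per-shell decay of the traversal count            (`pinchAway_perShellDecay`: the landed
                                                          Literature union bound `perShellDecay_of_pinchBound`)
    ⟹ `ShellCrossingBound`, `K = 1`, `λ = 3`, `δ₀ = 1`  (`shellCrossing_of_perShellDecay`: the landed
                                                          coarse-mesh count `Theorems.stub_travCount`)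

so that `shellCrossingBound_of_pinchAway : PinchAway → ShellCrossingBound` (statement unfolded, tree
vocabulary only).  Once the promoted item `PinchAway` is proved — by either landed transfer line
(`Theorems.stub_socketTransfer`: enlargement ∧ confinement positivity ∧ interior two-strand pinch ⟹
PinchAway; or seat -0's socket comparison) — the crux closes by this theorem alone.

Proofs are the skeleton's §2 (`pinchAwayAll_perShellDecay`, `bound_of_perShellDecay`), moved verbatim
modulo names. Mathlib anchors: `MeasureTheory.measure_mono`, `MeasureTheory.measure_empty`,
`Real.rpow_pos_of_pos`; H21 anchors: `perShellDecay_of_pinchBound` (`PinchUnionBound.lean`, p90167),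
`Curve.HasTraversals.of_le` (`CurveTortuosity.lean`), `Theorems.stub_travCount` (p81647). [folklore glue]
-/

noncomputable section
open MeasureTheory Set Metric
open scoped ENNReal
open Literature.Probability.RandomPlanarGeometry Literature.Probability.LatticeModels

namespace Summit.CriticalPhenomena.SAWScalingLimit.Theorems

/-- **Pinch bound away from the marked points ⟹ per-shell decay of the traversal count** for one
`(D, a, b)`: if for every `d > 0` the critical SAW polyline makes four separate traversals of
`D(y; η, R)` with probability `≤ C (η/R)^{1+s}` (`δ ≤ δ₁`, `δ ≤ η < R ≤ R₀`, `y` at distance `≥ d`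
from both marked points), then for every genuine shell `D(x; ρ, R)` and `ε > 0` some threshold `k`
and mesh bound `δ₁` give `P_δ[k separate traversals] ≤ ε` for `δ ≤ δ₁` — the landed union bound
`perShellDecay_of_pinchBound` (pigeonhole on a good middle circle + one-dimensional net) instantiated
with the critical SAW laws, the SAW polylines and the two marked points. [folklore glue] -/
theorem pinchAway_perShellDecay (D : DobrushinDomain) (a b : ℝ → Site 2)
    (hPA : ∀ d : ℝ, 0 < d → ∃ (C s R₀ δ₁ : ℝ), 0 < s ∧ 0 < R₀ ∧ 0 < δ₁ ∧
      ∀ δ ∈ Set.Ioc (0 : ℝ) δ₁, ∀ (y : ℂ) (η R : ℝ), δ ≤ η → η < R → R ≤ R₀ →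
        d ≤ dist y (D.pt 0) → d ≤ dist y (D.pt 1) →
          SAW.law D.carrier δ (a δ) (b δ)
              {γ | (⟨γ.walk.toCurve (meshPoint δ)⟩ : Curve ℂ).HasTraversals 4 y η R} ≤
            ENNReal.ofReal (C * (η / R) ^ (1 + s)))
    (x : ℂ) {ρ R : ℝ} (hρ : 0 < ρ) (hρR : ρ < R) {ε : ℝ} (hε : 0 < ε) :
    ∃ (k : ℕ) (δ₁ : ℝ), 0 < δ₁ ∧ ∀ δ ∈ Set.Ioc (0 : ℝ) δ₁,
      SAW.law D.carrier δ (a δ) (b δ)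
        {γ | (⟨γ.walk.toCurve (meshPoint δ)⟩ : Curve ℂ).HasTraversals k x ρ R} ≤ ENNReal.ofReal ε :=
  perShellDecay_of_pinchBound (α := fun δ => SAW.DomainSAW D.carrier δ (a δ) (b δ))
    (fun δ => SAW.law D.carrier δ (a δ) (b δ))
    (fun δ γ => (⟨γ.walk.toCurve (meshPoint δ)⟩ : Curve ℂ)) (D.pt 0) (D.pt 1) hPA x hρ hρR hε

/-- **Per-shell decay + coarse-mesh counting ⟹ the crux's bound** for one `(D, a, b)`, with `K = 1`,
`λ = 3` and the GLOBAL mesh threshold `δ₀ = 1`: for a genuine shell take `ε = (ρ/R)^3`, the `k₁, δ₁`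
of per-shell decay and the `N` of the landed coarse-mesh count `Theorems.stub_travCount` at `(ρ, δ₁)`;
the threshold `max k₁ N` works for `δ ≤ δ₁` by monotonicity in `k` (`Curve.HasTraversals.of_le`) and
for `δ > δ₁` because the event is empty. [folklore glue] -/
theorem shellCrossing_of_perShellDecay (D : DobrushinDomain) (a b : ℝ → Site 2)
    (hP : ∀ (x : ℂ) (ρ R : ℝ), 0 < ρ → ρ < R → ∀ ε : ℝ, 0 < ε → ∃ (k : ℕ) (δ₁ : ℝ), 0 < δ₁ ∧
      ∀ δ ∈ Set.Ioc (0 : ℝ) δ₁,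
        SAW.law D.carrier δ (a δ) (b δ)
          {γ | (⟨γ.walk.toCurve (meshPoint δ)⟩ : Curve ℂ).HasTraversals k x ρ R} ≤ ENNReal.ofReal ε) :
    ∃ (k : ℂ → ℝ → ℝ → ℕ) (K lam δ₀ : ℝ), 2 < lam ∧ 0 < δ₀ ∧ ∀ δ ∈ Set.Ioc (0 : ℝ) δ₀,
      ∀ (x : ℂ) (ρ R : ℝ), δ ≤ ρ → ρ < R → R ≤ 1 →
        SAW.law D.carrier δ (a δ) (b δ)
            {γ | (⟨γ.walk.toCurve (meshPoint δ)⟩ : Curve ℂ).HasTraversals (k x ρ R) x ρ R} ≤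
          ENNReal.ofReal (K * (ρ / R) ^ lam) := by
  classical
  have key : ∀ (x : ℂ) (ρ R : ℝ), ∃ k : ℕ, 0 < ρ → ρ < R → ∀ δ ∈ Set.Ioc (0 : ℝ) 1,
      SAW.law D.carrier δ (a δ) (b δ)
          {γ | (⟨γ.walk.toCurve (meshPoint δ)⟩ : Curve ℂ).HasTraversals k x ρ R} ≤
        ENNReal.ofReal ((ρ / R) ^ (3 : ℝ)) := by
    intro x ρ R
    by_cases h : 0 < ρ ∧ ρ < R
    · have hε : 0 < (ρ / R) ^ (3 : ℝ) := Real.rpow_pos_of_pos (div_pos h.1 (h.1.trans h.2)) _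
      obtain ⟨k₁, δ₁, hδ₁, hk₁⟩ := hP x ρ R h.1 h.2 _ hε
      obtain ⟨N, hN⟩ := Theorems.stub_travCount ρ δ₁ h.1 hδ₁
      refine ⟨max k₁ N, fun _ _ δ hδ => ?_⟩
      by_cases hle : δ ≤ δ₁
      · calc SAW.law D.carrier δ (a δ) (b δ)
              {γ | (⟨γ.walk.toCurve (meshPoint δ)⟩ : Curve ℂ).HasTraversals (max k₁ N) x ρ R}
            ≤ SAW.law D.carrier δ (a δ) (b δ)
              {γ | (⟨γ.walk.toCurve (meshPoint δ)⟩ : Curve ℂ).HasTraversals k₁ x ρ R} :=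
              measure_mono fun γ hγ => Curve.HasTraversals.of_le hγ (le_max_left _ _)
          _ ≤ ENNReal.ofReal ((ρ / R) ^ (3 : ℝ)) := hk₁ δ ⟨hδ.1, hle⟩
      · have hempty :
            {γ : SAW.DomainSAW D.carrier δ (a δ) (b δ) |
              (⟨γ.walk.toCurve (meshPoint δ)⟩ : Curve ℂ).HasTraversals (max k₁ N) x ρ R} = ∅ :=
          Set.eq_empty_iff_forall_notMem.2 fun γ hγ =>
            hN D.carrier δ (a δ) (b δ) γ x R (le_of_lt (not_le.1 hle)) h.2
              (Curve.HasTraversals.of_le hγ (le_max_right _ _))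
        rw [hempty, measure_empty]
        exact bot_le
    · exact ⟨0, fun h1' h2' => absurd ⟨h1', h2'⟩ h⟩
  choose k hk using key
  refine ⟨k, 1, 3, 1, by norm_num, one_pos, fun δ hδ x ρ R hδρ hρR _ => ?_⟩
  rw [one_mul]
  exact hk x ρ R (hδ.1.trans_le hδρ) hρR δ hδ

/-- **`ShellCrossingBound` from the two-strand pinch bound away from the marked points.**  The
hypothesis is VERBATIM the registered statement `stub_pinchAway` / `PinchAwayAll` of the crux's line
skeletons (socket-comparison S0; pinch-on-a-circle, conclusion of the landed
`Theorems.stub_socketTransfer`): for every Dobrushin domain with an endpoint approximation and every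
`d > 0`, four separate traversals of `D(y; η, R)` by the critical SAW polyline have probability
`≤ C (η/R)^{1+s}` for `δ ≤ δ₁`, `δ ≤ η < R ≤ R₀` and centres `y` at distance `≥ d` from both marked
points.  Conclusion: the crux BY NAME (`K = 1`, `λ = 3`, `δ₀ = 1`).  With this theorem in the tree the
crux closes from the single statement `PinchAway` by proved glue alone.  (Registered on the item as
the glue stub `shellCrossingBound_of_pinchAway`, stated as an implication so that name + signature
match the registration verbatim.) [folklore glue] -/
theorem shellCrossingBound_of_pinchAway :
    (∀ (D : DobrushinDomain) (a b : ℝ → Site 2), SAW.IsEndpointApprox D a b →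
      ∀ d : ℝ, 0 < d → ∃ (C s R₀ δ₁ : ℝ), 0 < s ∧ 0 < R₀ ∧ 0 < δ₁ ∧
        ∀ δ ∈ Set.Ioc (0 : ℝ) δ₁, ∀ (y : ℂ) (η R : ℝ), δ ≤ η → η < R → R ≤ R₀ →
          d ≤ dist y (D.pt 0) → d ≤ dist y (D.pt 1) →
            SAW.law D.carrier δ (a δ) (b δ)
                {γ | (⟨γ.walk.toCurve (meshPoint δ)⟩ : Curve ℂ).HasTraversals 4 y η R} ≤
              ENNReal.ofReal (C * (η / R) ^ (1 + s))) →
    Summit.CriticalPhenomena.SAWScalingLimit.Theses.SAWRenewalTightness.ShellCrossingBound :=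
  fun hPA D a b hab =>
    shellCrossing_of_perShellDecay D a b fun x _ _ hρ hρR _ hε =>
      pinchAway_perShellDecay D a b (hPA D a b hab) x hρ hρR hε

end Summit.CriticalPhenomena.SAWScalingLimit.Theorems
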